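import Mathlib
import HarnessLib
import HarnessLib.Audit
import Summits.ValiantsHypothesis.Statement
import Literature.Computability.AlgebraicComplexity.DeterminantalComplexity
import Literature.Computability.AlgebraicComplexity.DeterminantalComplexityProofs
import Literature.Computability.AlgebraicComplexity.EquivariantDC
import Literature.Computability.AlgebraicComplexity.LandsbergRessayre
import Literature.Computability.AlgebraicComplexity.AlperBogartVelascoSubspace
import Literature.Computability.AlgebraicComplexity.AlperBogartVelascoBoxThree
import Literature.Computability.AlgebraicComplexity.ValiantConjectureProofs
import Summits.ValiantsHypothesis.ValiantsHypothesis.Theorems.HubHub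
import Summits.ValiantsHypothesis.ValiantsHypothesis.Theorems.ProjectionStabilityOptStepStubGrenetProjection

/-!
Route: ProjectionRigidity

CLOSED (refuted) 2026-08-17T11:18:38Z by planner-rrefute-ValiantsHypothesis-ProjectionR-b9982f88-0 — reason: refuted:stmt-ValiantsHypothesis-16001 (ProjOptimalUnique) by Summit.ValiantsHypothesis.ValiantsHypothesis.Theorems.not_ProjOptimalUnique — note: route-repair (planner-rrefute-…-b9982f88): CLOSED refuted:ProjOptimalUnique — SUBSTANTIVE, no honest repair. Kill: K = P0·G3·(1+D)·Q0, the purified single-syzygy Koszul twist of Grenet's 7x7 (constants 0,±1, det = per_3, size 7 = pdc(per_3); Theorems/ProjOptimalUnique/Negative/PurifiedTwist.lean + P. The file is kept as the record of this route; refuted decls are indexed as negative knowledge (`ledger negatives`).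

# Route ProjectionRigidity — Grenet rigidity rescued in Valiant's projection model — unique optimal
projections of DET and a Laplace doubling give pdc(per_n) = 2^n − 1

RESCUER LENS (cycle 1): the CLOSED route GrenetRigidity (refuted 2026-08-15:
OptimalUnique/OptimalUniqueThree, stmt-3735/3738) run
again in the model where the refuting gauge cannot act. X (target): for every n ≥ 3, Grenet's
representation is optimal among
PROJECTIONS of the determinant — 2^n − 1 ≤ pdc(per_n), where pdc = `detProjectionComplexity` is
Valiant's original measure (entries of
the representing matrix are variables or constants, Valiant 1979 §2; Bürgisser 2000 §2.5), not the
affine dc of Mignon–Ressayre. The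
plan for X is the stability template exact → unique → bootstrap: ProjOptimalUnique (optimal
projections of per_n form ONE orbit of
constant gauge GL_m × GL_m × G_per × transpose — the refuted statement with its quantifier domain
cut to projection matrices),
ProjLaplaceDoubling (uniqueness plus the (n+1)² Laplace restrictions force 2^{n+1} − 1 ≤
pdc(per_{n+1}) from 2^n − 1 ≤ pdc(per_n)),
anchored at pdc(per_3) ≥ dc(per_3) = 7 (in tree), and the bridge PdcQpOfVp (VP ⇒ pdc
quasi-polynomially bounded). No card is realised
(the projection-model dodge is filed nowhere; nearest card grenet-rigid-cancellation-free uses the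
sign-coherent Pfaffian-cover model).
Lean: `∀ n ≥ 3, 2 ^ n - 1 ≤ Literature.Computability.AlgebraicComplexity.detProjectionComplexity
(Literature.Computability.AlgebraicComplexity.perPoly (Fin n) ℂ)`

## Assembly
Pure logic over facts PROVED in the tree (sorry-free as `closes` in glue.lean / Sketch.lean): by
`Nat.le_induction` from the base
2^3 − 1 = 7 = dc(per_3) ≤ pdc(per_3) (`alperBogartVelasco2017_cor_1_4_complex
alperBogartVelasco2017_cor_1_4_holds`,
`determinantalComplexity_le_detProjectionComplexity_holds`) and the step ProjLaplaceDoubling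
ProjOptimalUnique, 2^n − 1 ≤ pdc(per_n)
for all n ≥ 3; the explicit gap point n = 2^(2^j − c) of the template 2^{(log₂ n + c)^c} (inlined;
same arithmetic as
`Theorems/DetqpThesis/Negative/NotQPBoundedOfExp.lean`) makes n ↦ pdc(per_n) not quasi-polynomially
bounded, contradicting PdcQpOfVp
if per were a VP family; the hub `Hub.valiantsHypothesis_of_not_isVPFamily_per` with
`mem_VP_ofFintype_iff_holds` and `perFamily_mem_VNP_holds ℂ` gives VP ℂ ≠ VNP ℂ.

Rationale: WHY THIS LINE. The death certificate of GrenetRigidity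
(Theorems/GrenetRigidityOptimalUniqueRefutation.lean) names the killer exactly: affine
representations admit affineness-preserving POLYNOMIAL gauge moves — Koszul twists B = A(1+D), D a
matrix of linear syzygies of the
first-layer labels — invisible to constant P, Q; the same twist killed UlrichPadded.NoTightInfinity
(stmt-5668). In Valiant's projection
model (single variable or constant per cell, cancellations allowed, arbitrary complex constants)
these moves leave the model, and this
is now CHECKED rather than hoped: (a) the refuting witness B has cells X21−X20, X21+X00, X01+X00
and, by a column-span argument (every
column q of a purifying Q must make the span of the linear forms of B·q a coordinate subspace, which
forces q_{v1} = 0, so Q is singular),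
NO constant gauge image of B, of Bᵀ, or of B(γx) is a projection — stmt-3735/3738 do not touch
ProjOptimalUnique; (b) at n = 3 every
Koszul twist of Grenet creates a two-variable cell (pigeonhole on supports), at n ≥ 4 the pure
Koszul twists carry a sign that is not a
coboundary (odd 4-cycle in the variable-cell graph), so they are signed, not Valiant, projections;
(c) first-order test RUN this session
(compute/grenet_proj_tangent_n.py, exact arithmetic mod p): the constant cells of Grenet_3 (37
cells) and Grenet_4 (193 cells) admit NO
det-preserving first-order deformation beyond the pattern torus (deformation space dim 1 resp. 2 =
torus image), and no cofactor of
Grenet_3,4,5 vanishes identically (no free junk cell) — whereas in the affine model Grenet_3 sits in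
a ≥ 9-dimensional family of
inequivalent optimal representations. The base case is also in better shape than the affine one ever
was: Hüttenhain–Ikenmeyer
(arXiv:1410.8202 §4 Prop. 9, read) classify ALL 463 binary 7×7 projections of per_3 as one orbit of
GL_7(ℤ)² × transpose × (S_3×S_3 ⋊ ᵀ)
— their Example 10 (a dense projection, integer-gauge-equivalent to Grenet) is why uniqueness must
be modulo CONSTANT gauge and not
modulo relabelling. Imported area: the Simonovits/Keevash stability method (Keevash2011 §5) as in
the parent card, run on a SYNTACTIC
model; the bridge to the summit is classical and proved in spirit (DET is VQP-complete under
qp-PROJECTIONS: ValiantSTOC1979 Thm 1 with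
the formula-size bound, Burgisser2000 Prop 2.30/Cor 2.28, arXiv:2406.06217 Prop 2.23). Versus the
open routes RigidMinimalReps /
RigidityForcesSymmetry (affine model; minimality ⇒ torus symmetry ⇒ LR-type count; their
RigidAtThree is false in the affine model by
the same Koszul moduli) and PolyaContinued (projections of Pfaffian perfect-matching polynomials;
matching-minor monotonicity): no
symmetry is imposed or derived, cancellations are allowed, and the engine is induction on n through
Laplace restriction, which maps
projections to projections.

RANKED CRUXES. #0 Target (target) — X — Grenet is optimal among projections of DET: for every n ≥ 3,
2^n − 1 ≤ pdc(per_n) (hence = 2^n − 1 by GrenetProjection). (why it might fail: far stronger than VH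
(pdc = n^{O(log n)} is compatible with VP ≠ VNP); nothing beyond n²/2 ≤ dc ≤ pdc ≤ 2^n − 1 is known
and a 14×14 projection of per_4 kills it at once.) [Grenet2011, MignonRessayre2004,
AlperBogartVelasco2017, HuttenhainIkenmeyer2016, LandsbergRessayre2017]
#2 ProjOptimalUnique (crux) — [crux] DodgeProjOptimalUnique — for every n ≥ 3, any two m×m
PROJECTION matrices A, B (every entry a variable X v or a constant C c) with det = per_n at the
optimal size m = pdc(per_n) are equivalent under constant gauge, the symmetries of per_n and
transposition: B = P·A(γx)·Q or B = P·A(γx)ᵀ·Q with P, Q ∈ GL_m(ℂ), γ ∈ permSymmetrySubst. The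
refuted OptimalUnique (stmt-3735) with its quantifier domain restricted to projections and dc
replaced by pdc; the refuting Koszul twist is provably outside every such orbit (§ Why this line
(a)). [difficulty: XL] (why it might fail: HI16 Prop 9 covers 0/1 constants at n=3 only: a 7×7
projection with complex constants in a non-Grenet pattern, or at n=4 a second optimal pattern (a
pure twist whose sign cocycle IS a coboundary), refutes it; and it is moot wherever pdc(per_n) < 2^n
− 1.) [HuttenhainIkenmeyer2016, arXiv:1410.8202, AlperBogartVelasco2017, Grenet2011,
LandsbergRessayre2017, Nisan1991]
#3 ProjLaplaceDoubling (crux) — the bootstrapping (gluing) lemma in the projection model —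
ProjOptimalUnique and Grenet-optimality at n (2^n − 1 ≤ pdc(per_n)) imply 2^{n+1} − 1 ≤
pdc(per_{n+1}) for every n ≥ 3: the (n+1)² Laplace restrictions x_{n+1,j} := 1, rest of row n+1 and
column j := 0 of an optimal projection of per_{n+1} are PROJECTIONS computing per_n of the same
size; each reduces (HI16-style constant row/column operations plus Laplace along unit rows) to an
optimal core, a relabelled Grenet_n by uniqueness, whose vertices are identified by the
sub-permanent they compute; the n+1 cores of one row then cover all proper subsets of [n+1], forcing
≥ 2·(2^n − 1) + 1 rows. [deps: ProjOptimalUnique] [difficulty: XL] (why it might fail: restricted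
reps are non-optimal (window) projections whose reduction to optimal cores is HI16-empirical (n=3,
binary) only; cores overlap (Grenet_{n+1}: 2^{n−1}−1 pairwise) and cancelling cycle covers in
non-ABP projections may leave "vertex computes a sub-permanent" without meaning.) [Nisan1991,
Grenet2011, Keevash2011, arXiv:1410.8202, LandsbergRessayre2017]
#4 PdcQpOfVp (crux) — the bridge — if the permanent family is a VP family then n ↦ pdc(per_n) is
quasi-polynomially bounded (VP ⊆ VQP_e, tree `isVQPeFamily_iff_isVQPFamily`; a formula of size e is
a projection of DET_{e+2}, Valiant 1979 Thm 1 — the tree's `exists_isDetProjection` gives existence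
without the size bound, and `isQPBounded_determinantalComplexity_of_isVPFamily_holds` gives the
AFFINE bound). Known mathematics; ranked last; a hypothesis of `closes`. [difficulty: L] (why it
might fail: none mathematically (ValiantSTOC1979 Thm 1 + BCS97 Cor (21.40)); the risk is Lean cost —
the projection gadget with the formula-size bound, or the affine→projection expansion at poly(n)·dc
cost, is not yet in the tree.) [ValiantSTOC1979, Burgisser2000, arXiv:2406.06217]
#9 ProjOptimalUniqueThree (support) — the n = 3 instance at the known value pdc(per_3) = dc(per_3) =
7: any two 7×7 projection matrices over ℂ[x] with det = per_3 are equivalent under GL_7(ℂ)² × G_per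
× transpose (the projection form of the refuted OptimalUniqueThree, stmt-3738; binary case = HI16
Prop 9; the refuting twist is excluded by the column-span argument; Grenet_3 is in-pattern rigid,
this unit's computation). Decidable by enumeration of 7×7 patterns with symbolic constants (Gröbner
/ SAT + linear algebra). [difficulty: L] [HuttenhainIkenmeyer2016, arXiv:1410.8202,
AlperBogartVelasco2017]
#9 PdcPerFour (support) — the decisive small value pdc(per_4) = 15 — Grenet's 15×15 projection of
the 4×4 permanent is optimal among projections (Conjecture G, projection form, at n = 4: the first
value the doubling 2·7+1 predicts); certified computation over patterns (HI16 could not settle even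
the binary bdc(per_4)); not a hypothesis of `closes`. [difficulty: XL] [AlperBogartVelasco2017,
HuttenhainIkenmeyer2016, Grenet2011]
#9 GrenetProjection (support) — Grenet's representation is a PROJECTION of DET_{2^n − 1} (entries 0,
1 and single variables), so pdc(per_n) ≤ 2^n − 1; the tree proves the affine bound
`determinantalComplexity_perPoly_le` through the same matrix — re-prove it in projection form.
[difficulty: provable-now] [Grenet2011, LandsbergRessayre2017]

TWO-LAYER PLAN. Foreseen glued splits (k ≤ 3, depth 1, filed only when a crux closes or stalls with
a census): ProjLaplaceDoubling ⇐ ProjWindowReduction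
(every projection of per_n of size ≤ 2·pdc(per_n) is constant-gauge block-triangular over an optimal
projection core — the projection
form of the parent's WindowStability, which was moot, never refuted) → ProjCorePacking (the n+1
Grenet cores of the row-(n+1)
restrictions of one matrix cover ≥ 2^{n+1} − 2 rows: inclusion–exclusion over sub-permanent labels)
→ ProjLaplaceDoubling.
ProjOptimalUnique ⇐ ProjAcyclicNormalForm (an optimal projection is gauge-equivalent to a
DAG-plus-back-arc (branching-program) matrix:
cancelling cycle covers never pay at optimal size) → NisanCommutative (optimal projection ABPs of
per_n are layered and layer-unique, the
commutative shadow of Nisan 1991) → ProjOptimalUnique. PdcQpOfVp ⇐ formula-size pgadget (Valiant's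
construction with the size bound) →
VP ⊆ VQP_e (in tree).

KILL CRITERIA. A second GL_7(ℂ)²×G_per×ᵀ-orbit of 7×7 projections of per_3 (complex constants)
refutes ProjOptimalUniqueThree and ProjOptimalUnique at
n = 3: ONE restate to "n ≥ n₀" if the extra orbit is visibly sporadic, else close
`refuted:ProjOptimalUnique`. A projection of per_4 of
size ≤ 14 refutes Target and PdcPerFour and kills the doubling at n = 3: close
`refuted:ProjLaplaceDoubling` (VH survives elsewhere).
A second optimal orbit at n = 4 with pdc(per_4) = 15 refutes ProjOptimalUnique but not Target: pivot
to ProjWindowReduction +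
packing without uniqueness only if the extra orbit is also Grenet-cored, else close. pdc(per_n) =
2^{o(n)} proved anywhere refutes
Target — close. DetQP.DetqpThesis, RigidMinimalReps or any exponential dc bound proved elsewhere
supersedes the route.

NOT DECOMPOSED YET. The reduction/packing mechanism inside ProjLaplaceDoubling (ProjWindowReduction,
ProjCorePacking) and the branching-program normal form
behind ProjOptimalUnique are layer-2 children, kept for tenure; the model predicate "every entry is
X v or C c" is inlined (no
definition item); signed/toric projections (entries c·x) are deliberately EXCLUDED — in that larger
model uniqueness is false at n = 4
by the pure Koszul twist (rank of the x_{4,0}-coefficient rises to 2), recorded in NOTES.md §Dodge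
(iii); the exact-size arithmetic is
kept in pdc (no O(1) slack) because the induction needs equality with Grenet's count.

CHEAPEST FALSIFIER. RAN here (pure python, exact mod p; folder compute/): (1) in-pattern first-order
rigidity of Grenet_3 and Grenet_4 in the projection
model — PASSES (deformations = pattern torus; files grenet_proj_tangent_n.json); (2) no
identically-zero cofactor in Grenet_3,4,5 —
PASSES; (3) by hand: the refuting twist of stmt-3738 has no projection matrix in its constant-gauge
orbit (column-span argument,
NOTES.md). NOT run (kit-size, the refuter's first job): enumerate 7×7 projection PATTERNS with
symbolic complex constants and det = per_3
(HI16's nauty/SAT pipeline with constants as unknowns, Gröbner per pattern) — a second orbit kills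
rank 2 at n = 3; and a numerical /
SAT hunt for a 14×14 projection of per_4 or a non-Grenet 15×15 one.

NUMBERS. dc(per_3) = pdc(per_3) = 7 (AlperBogartVelasco2017 Cor 1.4 + Grenet; tree); 9 ≤ dc(per_4) ≤
pdc(per_4) ≤ 15; n²/2 ≤ dc ≤ pdc ≤ 2^n − 1
(MignonRessayre2004, Grenet2011, both in tree). Binary 7×7 projections of per_3: 463, ONE orbit
(HI16 Prop 9). Koszul twist family of
Grenet_3 in the AFFINE model: 9 parameters (3 columns × 3 syzygies); in the projection model: 0
(pigeonhole). In-pattern deformation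
space of Grenet's constants: n = 3: 37 cells, rank 36, dim 1 = torus; n = 4: 193 cells, rank 191,
dim 2 = torus. Items at open: 8
(target, 3 cruxes, 3 supports, assembly).

DEFINITION REQUESTS. None at open: `detProjectionComplexity`, `IsDetProjection`, `IsProjection`,
`permSymmetrySubst`, `Matrix.linSubstEntries`, `perPoly`,
`IsVPFamily`, `IsQPBounded` exist; the projection-entry predicate is inlined. A named
`IsProjectionMatrix` / pattern-gauge groupoid is
requested only with the layer-2 children.

Novelty: Searches (2026-08-16): `ledger negatives --problem ValiantsHypothesis` (4; two are the parent's);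
grep of all 63 Theses and 135 cards
for projection-model determinantal complexity (hits: PolyaContinued — projections of Pfaffian PM
polynomials; cards grenet-rigid-cancellation-free,
grenet-extended-gauge, rigidity-implies-grenet, integral-projections-char-two,
small-characteristic-profile-dc — none states uniqueness or a
bootstrap for Valiant projections); `lit search --source zbmath "binary determinantal complexity
permanent"` (1: HI16), `"determinantal
representation permanent unique Grenet"` (0), `"projection of the determinant permanent optimal"` (0
relevant); `lit galaxy search
"binary determinantal complexity" | "Grenet's determinantal representation of the permanent is
optimal" | "determinantal complexity"
--star all` (0, 0, 16 generic); `lit read arxiv:1410.8202` §3–4 (pp. 6–8: Prop 9, Example 10,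
bdc(per_4) infeasible); `lit frontier
ValiantsHypothesis --since 2020` (30 rows; 2026 items on symmetric classes arXiv:2601.09343 and a
multilinear-ABP barrier arXiv:2604.00746,
nothing on projection rigidity); local searchd / OpenAlex / S2 unavailable (connection reset, HTTP
429).
Nearest prior art found: HuttenhainIkenmeyer2016 (arXiv:1410.8202: binary projection model,
uniqueness at (3,7) by enumeration, no
asymptotic conjecture or induction); LandsbergRessayre2017 (Grenet optimal and unique among
equivariant expressions); the hub's own
GrenetRigidity (template, affine mode  [refs: 1410.8202, 2601.09343, 2604.00746, arxiv:1410.8202, HuttenhainIkenmeyer2016, LandsbergRessayre2017]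

Barriers (technique_class: stability-method, rigidity, projection-model): - technique_class: stability-method, rigidity, projection-model
- Literature.Barriers.ValiantsHypothesis.AlgebraicNaturalProofs: the argument quantifies over
representations of per_n only (uniqueness of an extremiser, an induction on n) and defines no
property of all polynomials of small pdc — not a distinguisher in the sense of
`NaturalProofAgainstVP`; conceded: no largeness leverage either, and "pdc ≤ m" is constructible in
the coefficients of per for fixed m like every dc-type bound.
- Literature.Barriers.ValiantsHypothesis.PermanentCharTwo: everything is over ℂ; in characteristic 2
per = det has pdc = n and uniqueness fails (moduli of optimal expressions), and the sign obstruction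
that excludes pure Koszul twists (odd cycles of −1's) disappears exactly in characteristic 2 — the
line is characteristic-sensitive by construction, as it must be.
- Literature.Barriers.ValiantsHypothesis.RankMethods: no rank / flattening / partial-derivative
measure is used (`PartialDerivativesDetPerm` moot); the 2026 min-partition-rank barrier for
multilinear ABPs (arXiv:2604.00746) is likewise not engaged — the engine is extremal uniqueness plus
induction, whose own risk is non-uniqueness, not rank saturation.
- Literature.Barriers.ValiantsHypothesis.MonotoneGap: constants of both signs and cancelling cycle
covers are allowed (the model is universal for VP up to quasi-polynomial size), so Jerrum–Snir
counting is neither used nor contradicted.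
- Negatives index: OptimalUnique (stmt-3735) / Opt

History (route lifecycle, newest last):
- 2026-08-17T10:58:16Z · BROKEN — ProjOptimalUnique (stmt-ValiantsHypothesis-16001, crux) refuted by Summit.ValiantsHypothesis.ValiantsHypothesis.Theorems.not_ProjOptimalUnique @ 616b35d018ac (prover-line-stmt-ValiantsHypothesis-16001-c1-0)
- 2026-08-17T11:18:40Z · CLOSED refuted — refuted:stmt-ValiantsHypothesis-16001 (ProjOptimalUnique) by Summit.ValiantsHypothesis.ValiantsHypothesis.Theorems.not_ProjOptimalUnique (planner-rrefute-ValiantsHypothesis-ProjectionR-b9982f88-0)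

sub-problem: ValiantsHypothesis · status: closed(refuted) · opened planner-plan-lens-ValiantsHypothesis-rescuer-v2-0 2026-08-16T16:11:07Z · rev 1 · ledger route-ValiantsHypothesis-ProjectionRigidity
GENERATED by the gate from the ledger (D-0016/17). Provers cite these decls: `theorem foo : Summit.ValiantsHypothesis.ValiantsHypothesis.Theses.ProjectionRigidity.<Decl> := …` in Summits/ValiantsHypothesis/ValiantsHypothesis/Theorems/<Name>.lean.
-/

namespace Summit.ValiantsHypothesis.ValiantsHypothesis.Theses.ProjectionRigidity

open scoped BigOperators Topology Manifold Classical MeasureTheory ProbabilityTheory Matrix InnerProductSpace ComplexConjugate ContinuousMap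
open Filter Set Function TopologicalSpace MeasureTheory

attribute [summit_statement] _root_.ValiantsHypothesis

open Literature.PNP

/-- item stmt-ValiantsHypothesis-16000 · target · rank 0 · open · by planner
why it might fail: far stronger than VH (pdc = n^{O(log n)} is compatible with VP ≠ VNP); nothing beyond n²/2 ≤ dc ≤ pdc ≤ 2^n − 1 is known and a 14×14 projection of per_4 kills it at once.
sources: Grenet2011, MignonRessayre2004, AlperBogartVelasco2017, HuttenhainIkenmeyer2016, LandsbergRessayre2017
[target] X — Grenet is optimal among projections of DET: for every n ≥ 3, 2^n − 1 ≤ pdc(per_n)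
(hence = 2^n − 1 by GrenetProjection). -/
@[route_item "route-ValiantsHypothesis-ProjectionRigidity"]
def Target : Prop :=
  ∀ n ≥ 3, 2 ^ n - 1 ≤ Literature.Computability.AlgebraicComplexity.detProjectionComplexity (Literature.Computability.AlgebraicComplexity.perPoly (Fin n) ℂ)

/-- item stmt-ValiantsHypothesis-16001 · crux · rank 2 · closed · refuted by Summit.ValiantsHypothesis.ValiantsHypothesis.Theorems.not_ProjOptimalUnique @ 616b35d018ac (prover) · by planner
why it might fail: HI16 Prop 9 covers 0/1 constants at n=3 only: a 7×7 projection with complex constants in a non-Grenet pattern, or at n=4 a second optimal pattern (a pure twist whose sign cocycle IS a coboundary), refutes it; and it is moot wherever pdc(per_n) < 2^n − 1.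
sources: HuttenhainIkenmeyer2016, arXiv:1410.8202, AlperBogartVelasco2017, Grenet2011, LandsbergRessayre2017, Nisan1991
[crux] [crux] DodgeProjOptimalUnique — for every n ≥ 3, any two m×m PROJECTION matrices A, B (every
entry a variable X v or a constant C c) with det = per_n at the optimal size m = pdc(per_n) are
equivalent under constant gauge, the symmetries of per_n and transposition: B = P·A(γx)·Q or B =
P·A(γx)ᵀ·Q with P, Q ∈ GL_m(ℂ), γ ∈ permSymmetrySubst. The refuted OptimalUnique (stmt-3735) with
its quantifier domain restricted to projections and dc replaced by pdc; the refuting Koszul twist is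
provably outside every such orbit (§ Why this line (a)). [difficulty: XL] -/
@[route_item "route-ValiantsHypothesis-ProjectionRigidity"]
def ProjOptimalUnique : Prop :=
  ∀ n ≥ 3, ∀ A B : Matrix (Fin (Literature.Computability.AlgebraicComplexity.detProjectionComplexity (Literature.Computability.AlgebraicComplexity.perPoly (Fin n) ℂ))) (Fin (Literature.Computability.AlgebraicComplexity.detProjectionComplexity (Literature.Computability.AlgebraicComplexity.perPoly (Fin n) ℂ))) (MvPolynomial (Fin n × Fin n) ℂ), (∀ i j, (∃ v, A i j = MvPolynomial.X v) ∨ ∃ c, A i j = MvPolynomial.C c) → (∀ i j, (∃ v, B i j = MvPolynomial.X v) ∨ ∃ c, B i j = MvPolynomial.C c) → A.det = Literature.Computability.AlgebraicComplexity.perPoly (Fin n) ℂ → B.det = Literature.Computability.AlgebraicComplexity.perPoly (Fin n) ℂ → ∃ (P Q : GL (Fin (Literature.Computability.AlgebraicComplexity.detProjectionComplexity (Literature.Computability.AlgebraicComplexity.perPoly (Fin n) ℂ))) ℂ) (γ : GL (Fin n × Fin n) ℂ), γ ∈ Literature.Computability.AlgebraicComplexity.permSymmetrySubst ℂ n ∧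 (B = (P : Matrix _ _ ℂ).map MvPolynomial.C * Literature.Computability.AlgebraicComplexity.Matrix.linSubstEntries γ A * (Q : Matrix _ _ ℂ).map MvPolynomial.C ∨ B = (P : Matrix _ _ ℂ).map MvPolynomial.C * (Literature.Computability.AlgebraicComplexity.Matrix.linSubstEntries γ A).transpose * (Q : Matrix _ _ ℂ).map MvPolynomial.C)

/-- item stmt-ValiantsHypothesis-16002 · crux · rank 3 · closed · moot by None · by planner
why it might fail: restricted reps are non-optimal (window) projections whose reduction to optimal cores is HI16-empirical (n=3, binary) only; cores overlap (Grenet_{n+1}: 2^{n−1}−1 pairwise) and cancelling cycle covers in non-ABP projections may leave "vertex computes a sub-permanent" without meaning.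
sources: Nisan1991, Grenet2011, Keevash2011, arXiv:1410.8202, LandsbergRessayre2017
[crux] the bootstrapping (gluing) lemma in the projection model — ProjOptimalUnique and
Grenet-optimality at n (2^n − 1 ≤ pdc(per_n)) imply 2^{n+1} − 1 ≤ pdc(per_{n+1}) for every n ≥ 3:
the (n+1)² Laplace restrictions x_{n+1,j} := 1, rest of row n+1 and column j := 0 of an optimal
projection of per_{n+1} are PROJECTIONS computing per_n of the same size; each reduces (HI16-style
constant row/column operations plus Laplace along unit rows) to an optimal core, a relabelled
Grenet_n by uniqueness, whose vertices are identified by the sub-permanent they compute; the n+1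
cores of one row then cover all proper subsets of [n+1], forcing ≥ 2·(2^n − 1) + 1 rows. [deps:
ProjOptimalUnique] [difficulty: XL] -/
@[route_item "route-ValiantsHypothesis-ProjectionRigidity"]
def ProjLaplaceDoubling : Prop :=
  ProjOptimalUnique → ∀ n ≥ 3, 2 ^ n - 1 ≤ Literature.Computability.AlgebraicComplexity.detProjectionComplexity (Literature.Computability.AlgebraicComplexity.perPoly (Fin n) ℂ) → 2 ^ (n + 1) - 1 ≤ Literature.Computability.AlgebraicComplexity.detProjectionComplexity (Literature.Computability.AlgebraicComplexity.perPoly (Fin (n + 1)) ℂ)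

/-- item stmt-ValiantsHypothesis-16003 · crux · rank 4 · closed · proved by Summit.ValiantsHypothesis.ValiantsHypothesis.Theorems.ProjectionStabilityPdcQpOfVp.pdcQpOfVp_proof @ 7c8b420fa0e2 (prover) · by planner
why it might fail: none mathematically (ValiantSTOC1979 Thm 1 + BCS97 Cor (21.40)); the risk is Lean cost — the projection gadget with the formula-size bound, or the affine→projection expansion at poly(n)·dc cost, is not yet in the tree.
sources: ValiantSTOC1979, Burgisser2000, arXiv:2406.06217
[crux] the bridge — if the permanent family is a VP family then n ↦ pdc(per_n) is quasi-polynomially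
bounded (VP ⊆ VQP_e, tree `isVQPeFamily_iff_isVQPFamily`; a formula of size e is a projection of
DET_{e+2}, Valiant 1979 Thm 1 — the tree's `exists_isDetProjection` gives existence without the size
bound, and `isQPBounded_determinantalComplexity_of_isVPFamily_holds` gives the AFFINE bound). Known
mathematics; ranked last; a hypothesis of `closes`. [difficulty: L] -/
@[route_item "route-ValiantsHypothesis-ProjectionRigidity"]
def PdcQpOfVp : Prop :=
  Literature.Computability.AlgebraicComplexity.IsVPFamily (fun n => Literature.Computability.AlgebraicComplexity.perPoly (Fin n) ℂ) → Literature.Computability.AlgebraicComplexity.IsQPBounded (fun n => Literature.Computability.AlgebraicComplexity.detProjectionComplexity (Literature.Computability.AlgebraicComplexity.perPoly (Fin n) ℂ))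

/-- item stmt-ValiantsHypothesis-16004 · support · rank 9 · closed · moot by None · by planner
sources: HuttenhainIkenmeyer2016, arXiv:1410.8202, AlperBogartVelasco2017
[support] the n = 3 instance at the known value pdc(per_3) = dc(per_3) = 7: any two 7×7 projection
matrices over ℂ[x] with det = per_3 are equivalent under GL_7(ℂ)² × G_per × transpose (the
projection form of the refuted OptimalUniqueThree, stmt-3738; binary case = HI16 Prop 9; the
refuting twist is excluded by the column-span argument; Grenet_3 is in-pattern rigid, this unit's
computation). Decidable by enumeration of 7×7 patterns with symbolic constants (Gröbner / SAT +
linear algebra). [difficulty: L] -/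
@[route_item "route-ValiantsHypothesis-ProjectionRigidity"]
def ProjOptimalUniqueThree : Prop :=
  ∀ A B : Matrix (Fin 7) (Fin 7) (MvPolynomial (Fin 3 × Fin 3) ℂ), (∀ i j, (∃ v, A i j = MvPolynomial.X v) ∨ ∃ c, A i j = MvPolynomial.C c) → (∀ i j, (∃ v, B i j = MvPolynomial.X v) ∨ ∃ c, B i j = MvPolynomial.C c) → A.det = Literature.Computability.AlgebraicComplexity.perPoly (Fin 3) ℂ → B.det = Literature.Computability.AlgebraicComplexity.perPoly (Fin 3) ℂ → ∃ (P Q : GL (Fin 7) ℂ) (γ : GL (Fin 3 × Fin 3) ℂ), γ ∈ Literature.Computability.AlgebraicComplexity.permSymmetrySubst ℂ 3 ∧ (B = (P : Matrix (Fin 7) (Fin 7) ℂ).map MvPolynomial.C * Literature.Computability.AlgebraicComplexity.Matrix.linSubstEntries γ A * (Q : Matrix (Fin 7) (Fin 7) ℂ).map MvPolynomial.C ∨ B = (P : Matrix (Fin 7) (Fin 7) ℂ).map MvPolynomial.C * (Literature.Computability.AlgebraicComplexity.Matrix.linSubstEntries γ A).transpose * (Q : Matrix (Fin 7) (Fin 7)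 ℂ).map MvPolynomial.C)

/-- item stmt-ValiantsHypothesis-16005 · support · rank 9 · closed · moot by None · by planner
sources: AlperBogartVelasco2017, HuttenhainIkenmeyer2016, Grenet2011
[support] the decisive small value pdc(per_4) = 15 — Grenet's 15×15 projection of the 4×4 permanent
is optimal among projections (Conjecture G, projection form, at n = 4: the first value the doubling
2·7+1 predicts); certified computation over patterns (HI16 could not settle even the binary
bdc(per_4)); not a hypothesis of `closes`. [difficulty: XL] -/
@[route_item "route-ValiantsHypothesis-ProjectionRigidity"]
def PdcPerFour : Prop :=
  Literature.Computability.AlgebraicComplexity.detProjectionComplexity (Literature.Computability.AlgebraicComplexity.perPoly (Fin 4) ℂ) = 15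

/-- item stmt-ValiantsHypothesis-16006 · support · rank 9 · closed · proved by Summit.ValiantsHypothesis.ValiantsHypothesis.Theorems.ProjectionStabilityOptStep.GrenetProjection.stub_grenetProjection @ 93cfc0c3bac2 (prover) · by planner
sources: Grenet2011, LandsbergRessayre2017
[support] Grenet's representation is a PROJECTION of DET_{2^n − 1} (entries 0, 1 and single
variables), so pdc(per_n) ≤ 2^n − 1; the tree proves the affine bound
`determinantalComplexity_perPoly_le` through the same matrix — re-prove it in projection form.
[difficulty: provable-now] -/
@[route_item "route-ValiantsHypothesis-ProjectionRigidity"]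
def GrenetProjection : Prop :=
  ∀ n ≥ 1, Literature.Computability.AlgebraicComplexity.IsDetProjection (Literature.Computability.AlgebraicComplexity.perPoly (Fin n) ℂ) (2 ^ n - 1)

/-- `GrenetProjection` holds: proved by `Summit.ValiantsHypothesis.ValiantsHypothesis.Theorems.ProjectionStabilityOptStep.GrenetProjection.stub_grenetProjection` @ 93cfc0c3bac2. -/
theorem GrenetProjection_holds : GrenetProjection := _root_.Summit.ValiantsHypothesis.ValiantsHypothesis.Theorems.ProjectionStabilityOptStep.GrenetProjection.stub_grenetProjection

/-- item stmt-ValiantsHypothesis-16007 · assembly · rank 1 · closed · moot by None · by planner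
sources: ValiantSTOC1979, Burgisser2000, AlperBogartVelasco2017
[assembly] ProjOptimalUnique → ProjLaplaceDoubling → PdcQpOfVp → ValiantsHypothesis. -/
@[route_item "route-ValiantsHypothesis-ProjectionRigidity"]
def Assembly : Prop :=
  ProjOptimalUnique → ProjLaplaceDoubling → PdcQpOfVp → ValiantsHypothesis

end Summit.ValiantsHypothesis.ValiantsHypothesis.Theses.ProjectionRigidity
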